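import Summits.RiemannHypothesis.RiemannHypothesis.Theorems.S2FormatCE0Sound
import HarnessLib

/-!
# Format C at `S = {∞, 2}` — (E0) soundness, part 2: the banded checks and `Valid`

File 4/4 of the (E0) base (seat cc-s2-4, `HOME/cc-s2-4/CC4-LEAN.md` §9.2).  Soundness of the per-mode bands
(`sound_checkB/Bd/C/Cp/D`: `S0/S2/Sdiag` with explicit dominations `e/(l²+ω²) ≤ e_K(4/(4K+1)²)r^j`, `e l²/(l²+ω²) ≤ e`,
`|l²−ω²| ≤ l²+ω²`; `ψ(¼+iω_n/2)` via `MC.mem_digammaBox_table`, `ψ′` via `MC.mem_trigammaBox`, `e^{iω_n log 2}` via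
`MC.mem_expI`) and the END-TO-END theorem **`E0.valid_of_checks`**: the Booleans `checkA`, `checkB 0 (M₃+1)`,
`checkBd 0 (M₁+1)`, `checkC 0 (M₃+1)`, `checkCp 0 (M₁+1)`, `checkD 0 (M₃+1)` (band ends as numerals) give `T.Valid b` —
exactly the hypothesis the (E) entry mirror consumes.
-/

set_option linter.dupNamespace false
set_option autoImplicit false

noncomputable section

open Complex Set MeasureTheory Filter Finset
open scoped Real Topology ComplexConjugate BigOperators

namespace Summit.RiemannHypothesis.RiemannHypothesis.Theorems.S2FormatC

open Literature.Analysis.SpecialFunctions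

section E0
open Literature.Analysis.ValidatedNumerics.NumericsMP

namespace E0

/-! ### Soundness, part 3: the banded checks and the assembly of `Valid` -/

section SoundBands
open Real

variable {P : Params} {T : EntryInputs} {X : Aux} {b : ℝ}

/-- `List.all` over `range' n₀ k` as a bounded quantifier. -/
theorem all_range'_iff {f : ℕ → Bool} {n₀ k : ℕ} :
    (List.range' n₀ k).all f = true ↔ ∀ n, n₀ ≤ n → n < n₀ + k → f n = true := by
  simp only [List.all_eq_true, List.mem_range'_1]
  exact ⟨fun h n h1 h2 ↦ h n ⟨h1, h2⟩, fun h n hn ↦ h n hn.1 hn.2⟩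

/-- `r = e^{−4b} < 1` (read off the checked box). -/
theorem r_lt_one (F : AFacts P T X b) : Real.exp (-(4 * b)) < 1 := by
  have := MI.lt_of_hi_lt_lo F.r (MI.mem_ofInt T.S 1)
    (by show X.rBox.hi < (1 : ℤ) * (T.S : ℤ); simpa using F.rlt)
  exact_mod_cast this

/-- `l_k² + ω_n² ∈ denBoxOf`. -/
theorem mem_denBoxOf (F : AFacts P T X b) {n : ℕ} (hn : n ≤ T.M₃) (k : ℕ) :
    MI.mem T.S (digammaNode k ^ 2 + omega b n ^ 2) (denBoxOf T X n k) :=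
  MI.mem_add (mem_lSqBox T.S k) (MI.mem_sqr F.hS (F.om n hn))

/-- `l_K² = (4K+1)²/4 ≤ l_{j+K}² + ω²`. -/
theorem lSq_le_den (b : ℝ) (n : ℤ) (j K : ℕ) :
    (((4 * K + 1) ^ 2 : ℕ) : ℝ) / ((4 : ℕ) : ℝ) ≤ digammaNode (j + K) ^ 2 + omega b n ^ 2 := by
  have e : (((4 * K + 1) ^ 2 : ℕ) : ℝ) / ((4 : ℕ) : ℝ) = digammaNode K ^ 2 := by
    rw [digammaNode_sq]; push_cast; ring
  rw [e]
  have h1 : digammaNode K ^ 2 ≤ digammaNode (j + K) ^ 2 :=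
    pow_le_pow_left₀ (digammaNode_pos K).le (digammaNode_mono (by omega)) 2
  nlinarith [sq_nonneg (omega b n)]

/-- The common tail estimate `e_{j+K}/(l_{j+K}² + ω²) ≤ e_K (4/(4K+1)²) r^j`. -/
theorem e_div_den_le (b : ℝ) (n : ℤ) (j K : ℕ) :
    eNode b (j + K) / (digammaNode (j + K) ^ 2 + omega b n ^ 2)
      ≤ eNode b K * (((4 : ℕ) : ℝ) / (((4 * K + 1) ^ 2 : ℕ) : ℝ)) * Real.exp (-(4 * b)) ^ j := by
  have hq : (0 : ℝ) < (((4 * K + 1) ^ 2 : ℕ) : ℝ) / ((4 : ℕ) : ℝ) := by positivity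
  have hden := lSq_le_den b n j K
  have hnum : 0 ≤ eNode b (j + K) := (eNode_pos b _).le
  calc eNode b (j + K) / (digammaNode (j + K) ^ 2 + omega b n ^ 2)
      ≤ eNode b (j + K) / ((((4 * K + 1) ^ 2 : ℕ) : ℝ) / ((4 : ℕ) : ℝ)) :=
        div_le_div_of_nonneg_left hnum hq hden
    _ = eNode b K * (((4 : ℕ) : ℝ) / (((4 * K + 1) ^ 2 : ℕ) : ℝ)) * Real.exp (-(4 * b)) ^ j := by
        rw [eNode_add]
        have : (0 : ℝ) < (((4 * K + 1) ^ 2 : ℕ) : ℝ) := by positivity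
        field_simp

/-- `S0_n ∈ S0BoxOf` (partial sum + geometric tail `e_K (4/(4K+1)²)/(1−r)`). -/
theorem mem_S0BoxOf (F : AFacts P T X b) {n : ℕ} (hn : n ≤ T.M₃) {I : MI} (h : S0BoxOf T P X n = some I) :
    MI.mem T.S (S0 b n) I := by
  unfold S0BoxOf at h
  have hr0 : 0 ≤ Real.exp (-(4 * b)) := (Real.exp_pos _).le
  have hdom : ∀ j, |(fun k ↦ eNode b k / (digammaNode k ^ 2 + omega b n ^ 2)) (j + P.Ke)|
      ≤ eNode b P.Ke * (((4 : ℕ) : ℝ) / (((4 * P.Ke + 1) ^ 2 : ℕ) : ℝ)) * Real.exp (-(4 * b)) ^ j := by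
    intro j
    have hpos : 0 ≤ eNode b (j + P.Ke) / (digammaNode (j + P.Ke) ^ 2 + omega b n ^ 2) := by
      have := eNode_pos b (j + P.Ke); have := digammaNode_pos (j + P.Ke); positivity
    simp only [abs_of_nonneg hpos]
    exact e_div_den_le b n j P.Ke
  obtain ⟨hsum, htail⟩ := tail_bound (g := fun k ↦ eNode b k / (digammaNode k ^ 2 + omega b n ^ 2))
    (K := P.Ke) hr0 (r_lt_one F) hdom
  refine mem_addTail (g := fun k ↦ eNode b k / (digammaNode k ^ 2 + omega b n ^ 2))
    (fun A hA ↦ mem_psum P.Ke (fun k hk J hJ ↦ ?_) hA) hsum ?_ h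
  · unfold termS0 at hJ
    exact MI.mem_divPos F.hS hJ (F.e k hk.le) (mem_denBoxOf F hn k)
  · refine mem_tailBox F.hS (F.e P.Ke le_rfl) F.r F.rlt (by positivity)
      (tsum_nonneg fun j ↦ by
        have := eNode_pos b (j + P.Ke); have := digammaNode_pos (j + P.Ke); positivity) ?_
    exact (le_abs_self _).trans htail

/-- `S2_n ∈ S2BoxOf` (partial sum + geometric tail `e_K/(1−r)`). -/
theorem mem_S2BoxOf (F : AFacts P T X b) {n : ℕ} (hn : n ≤ T.M₃) {I : MI} (h : S2BoxOf T P X n = some I) :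
    MI.mem T.S (S2 b n) I := by
  unfold S2BoxOf at h
  have hr0 : 0 ≤ Real.exp (-(4 * b)) := (Real.exp_pos _).le
  have hdom : ∀ j, |(fun k ↦ eNode b k * digammaNode k ^ 2 / (digammaNode k ^ 2 + omega b n ^ 2)) (j + P.Ke)|
      ≤ eNode b P.Ke * (((1 : ℕ) : ℝ) / ((1 : ℕ) : ℝ)) * Real.exp (-(4 * b)) ^ j := by
    intro j
    have he := eNode_pos b (j + P.Ke)
    have hl := digammaNode_pos (j + P.Ke)
    have hden : 0 < digammaNode (j + P.Ke) ^ 2 + omega b n ^ 2 := by positivity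
    have hpos : 0 ≤ eNode b (j + P.Ke) * digammaNode (j + P.Ke) ^ 2 / (digammaNode (j + P.Ke) ^ 2 + omega b n ^ 2) := by
      positivity
    simp only [abs_of_nonneg hpos]
    rw [div_le_iff₀ hden, eNode_add]
    push_cast
    nlinarith [sq_nonneg (omega b n), pow_nonneg hr0 j, (eNode_pos b P.Ke).le,
      mul_nonneg (mul_nonneg (eNode_pos b P.Ke).le (pow_nonneg hr0 j)) (sq_nonneg (omega b n))]
  obtain ⟨hsum, htail⟩ := tail_bound
    (g := fun k ↦ eNode b k * digammaNode k ^ 2 / (digammaNode k ^ 2 + omega b n ^ 2)) (K := P.Ke)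
    hr0 (r_lt_one F) hdom
  refine mem_addTail (g := fun k ↦ eNode b k * digammaNode k ^ 2 / (digammaNode k ^ 2 + omega b n ^ 2))
    (fun A hA ↦ mem_psum P.Ke (fun k hk J hJ ↦ ?_) hA) hsum ?_ h
  · unfold termS2 at hJ
    exact MI.mem_divPos F.hS hJ (MI.mem_mul F.hS (F.e k hk.le) (mem_lSqBox T.S k)) (mem_denBoxOf F hn k)
  · refine mem_tailBox F.hS (F.e P.Ke le_rfl) F.r F.rlt (by positivity)
      (tsum_nonneg fun j ↦ by
        have := eNode_pos b (j + P.Ke); have := digammaNode_pos (j + P.Ke); positivity) ?_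
    exact (le_abs_self _).trans htail

/-- `Sdiag_n ∈ SdiagBoxOf` (partial sum ± geometric tail `e_K (4/(4K+1)²)/(1−r)`). -/
theorem mem_SdiagBoxOf (F : AFacts P T X b) {n : ℕ} (hn : n ≤ T.M₃) {I : MI}
    (h : SdiagBoxOf T P X n = some I) : MI.mem T.S (Sdiag b n) I := by
  unfold SdiagBoxOf at h
  have hr0 : 0 ≤ Real.exp (-(4 * b)) := (Real.exp_pos _).le
  have hdom : ∀ j, |(fun k ↦ eNode b k * (digammaNode k ^ 2 - omega b n ^ 2) /
      (digammaNode k ^ 2 + omega b n ^ 2) ^ 2) (j + P.Ke)|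
      ≤ eNode b P.Ke * (((4 : ℕ) : ℝ) / (((4 * P.Ke + 1) ^ 2 : ℕ) : ℝ)) * Real.exp (-(4 * b)) ^ j := by
    intro j
    have he := eNode_pos b (j + P.Ke)
    have hl := digammaNode_pos (j + P.Ke)
    have hden : 0 < digammaNode (j + P.Ke) ^ 2 + omega b n ^ 2 := by positivity
    refine le_trans ?_ (e_div_den_le b n j P.Ke)
    simp only
    rw [abs_div, abs_mul, abs_of_pos he, abs_of_pos (by positivity : 0 < (digammaNode (j + P.Ke) ^ 2 + omega b n ^ 2) ^ 2),
      div_le_div_iff₀ (by positivity) hden]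
    have habs : |digammaNode (j + P.Ke) ^ 2 - omega b n ^ 2| ≤ digammaNode (j + P.Ke) ^ 2 + omega b n ^ 2 := by
      rw [abs_le]; constructor <;> nlinarith [sq_nonneg (omega b n), sq_nonneg (digammaNode (j + P.Ke))]
    calc eNode b (j + P.Ke) * |digammaNode (j + P.Ke) ^ 2 - omega b n ^ 2| * (digammaNode (j + P.Ke) ^ 2 + omega b n ^ 2)
        ≤ eNode b (j + P.Ke) * (digammaNode (j + P.Ke) ^ 2 + omega b n ^ 2) * (digammaNode (j + P.Ke) ^ 2 + omega b n ^ 2) := by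
          gcongr
      _ = eNode b (j + P.Ke) * (digammaNode (j + P.Ke) ^ 2 + omega b n ^ 2) ^ 2 := by ring
  obtain ⟨hsum, htail⟩ := tail_bound (g := fun k ↦ eNode b k * (digammaNode k ^ 2 - omega b n ^ 2) /
      (digammaNode k ^ 2 + omega b n ^ 2) ^ 2) (K := P.Ke) hr0 (r_lt_one F) hdom
  refine mem_addTail (g := fun k ↦ eNode b k * (digammaNode k ^ 2 - omega b n ^ 2) /
      (digammaNode k ^ 2 + omega b n ^ 2) ^ 2)
    (fun A hA ↦ mem_psum P.Ke (fun k hk J hJ ↦ ?_) hA) hsum ?_ h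
  · unfold termSdiag at hJ
    exact MI.mem_divPos F.hS hJ (MI.mem_mul F.hS (F.e k hk.le)
      (MI.mem_sub (mem_lSqBox T.S k) (MI.mem_sqr F.hS (F.om n hn)))) (MI.mem_sqr F.hS (mem_denBoxOf F hn k))
  · exact mem_tailBoxSym F.hS (F.e P.Ke le_rfl) F.r F.rlt (by positivity) htail

/-- **`checkB` is sound** (`S0`, `S2` on a band). -/
theorem sound_checkB (F : AFacts P T X b) {n₀ k : ℕ} (h : checkB P T X n₀ k = true) :
    ∀ n, n₀ ≤ n → n < n₀ + k → n ≤ T.M₃ →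
      MI.mem T.S (S0 b n) (T.S0Box.getD n default) ∧ MI.mem T.S (S2 b n) (T.S2Box.getD n default) := by
  unfold checkB at h
  rw [all_range'_iff] at h
  intro n h1 h2 hn
  have := h n h1 h2
  simp only [Bool.and_eq_true] at this
  exact ⟨mem_of_optIncl this.1 (fun I hI ↦ mem_S0BoxOf F hn hI),
    mem_of_optIncl this.2 (fun I hI ↦ mem_S2BoxOf F hn hI)⟩

/-- **`checkBd` is sound** (`Sdiag` on a band). -/
theorem sound_checkBd (F : AFacts P T X b) {n₀ k : ℕ} (h : checkBd P T X n₀ k = true) :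
    ∀ n, n₀ ≤ n → n < n₀ + k → n ≤ T.M₃ → MI.mem T.S (Sdiag b n) (T.SdiagBox.getD n default) := by
  unfold checkBd at h
  rw [all_range'_iff] at h
  intro n h1 h2 hn
  exact mem_of_optIncl (h n h1 h2) (fun I hI ↦ mem_SdiagBoxOf F hn hI)

/-- The evaluation point `w_n = ¼ + iω_n/2` lies in `wBoxOf`. -/
theorem mem_wBoxOf (F : AFacts P T X b) {n : ℕ} (hn : n ≤ T.M₃) :
    MC.mem T.S (1 / 4 + (omega b n : ℂ) / 2 * I) (wBoxOf T X n) := by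
  have h := MC.mem_mk' (MI.mem_ofFrac T.S 1 (q := 4) (by norm_num)) (MI.mem_divNat (F.om n hn) (n := 2) (by norm_num))
  have e : (1 / 4 + (omega b n : ℂ) / 2 * I) = ⟨((1 : ℤ) : ℝ) / ((4 : ℕ) : ℝ), omega b n / ((2 : ℕ) : ℝ)⟩ := by
    apply Complex.ext <;> simp
  rw [e]; exact h

/-- The tree's `bernoulliTable` satisfies the hypotheses of `mem_trigammaBox`. -/
theorem bernoulliTable_ok :
    MC.bernoulliTable ≠ [] ∧ ∀ k < MC.bernoulliTable.length,
      ((MC.bernoulliTable.getD k 0 : ℚ) : ℂ) = (bernoulli (2 * (k + 1)) : ℂ) := by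
  refine ⟨by simp [MC.bernoulliTable], fun k hk ↦ ?_⟩
  have hk' : k < 10 := by simpa [MC.bernoulliTable] using hk
  exact_mod_cast MC.bernoulliTable_getD hk'

/-- **`checkC` is sound** (`Im ψ`, and `Re ψ` for `n ≤ M₁ + 1`, on a band). -/
theorem sound_checkC (F : AFacts P T X b) {n₀ k : ℕ} (h : checkC P T X n₀ k = true) :
    ∀ n, n₀ ≤ n → n < n₀ + k → n ≤ T.M₃ →
      MI.mem T.S (imPsi b n) (T.imPsiBox.getD n default) ∧
      (n ≤ T.M₁ + 1 → MI.mem T.S (rePsi b n) (T.rePsiBox.getD n default)) := by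
  unfold checkC at h
  rw [all_range'_iff] at h
  intro n h1 h2 hn
  have hc := h n h1 h2
  split at hc
  · rename_i Y hY
    simp only [Bool.and_eq_true, Bool.or_eq_true, Bool.not_eq_true', decide_eq_false_iff_not] at hc
    have hψ := MC.mem_digammaBox_table F.hS F.pi hY (mem_wBoxOf F hn)
    refine ⟨mem_of_incl (by unfold imPsi; exact hψ.2) hc.1, fun hM ↦ ?_⟩
    rcases hc.2 with hno | hyes
    · exact absurd hM hno
    · unfold rePsi reDigammaQuarter; exact mem_of_incl hψ.1 hyes
  · exact absurd hc Bool.false_ne_true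

/-- **`checkCp` is sound** (`Re ψ′` on a band). -/
theorem sound_checkCp (F : AFacts P T X b) {n₀ k : ℕ} (h : checkCp P T X n₀ k = true) :
    ∀ n, n₀ ≤ n → n < n₀ + k → n ≤ T.M₃ → MI.mem T.S (rePsi' b n) (T.rePsi'Box.getD n default) := by
  unfold checkCp at h
  rw [all_range'_iff] at h
  intro n h1 h2 hn
  have hc := h n h1 h2
  split at hc
  · rename_i Y hY
    have hψ := MC.mem_trigammaBox F.hS bernoulliTable_ok.1 bernoulliTable_ok.2 hY (mem_wBoxOf F hn)
    unfold rePsi'; exact mem_of_incl hψ.1 hc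
  · exact absurd hc Bool.false_ne_true

/-- **`checkD` is sound** (`cos`, `sin` on a band). -/
theorem sound_checkD (F : AFacts P T X b) {n₀ k : ℕ} (h : checkD P T X n₀ k = true) :
    ∀ n, n₀ ≤ n → n < n₀ + k → n ≤ T.M₃ →
      MI.mem T.S (Real.sin (omega b n * Real.log 2)) (T.sinBox.getD n default) ∧
      MI.mem T.S (Real.cos (omega b n * Real.log 2)) (T.cosBox.getD n default) := by
  unfold checkD at h
  rw [all_range'_iff] at h
  intro n h1 h2 hn
  have hc := h n h1 h2
  split at hc
  · rename_i C hC
    simp only [Bool.and_eq_true] at hc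
    have hθ : MI.mem T.S (omega b n * Real.log 2) (thetaBoxOf T X n) := MI.mem_mul F.hS (F.om n hn) F.logTwo
    have hcis := MC.mem_expI F.hS F.pi hC hθ
    refine ⟨mem_of_incl ?_ hc.2, mem_of_incl ?_ hc.1⟩
    · have := hcis.2; rwa [Complex.exp_ofReal_mul_I_im] at this
    · have := hcis.1; rwa [Complex.exp_ofReal_mul_I_re] at this
  · exact absurd hc Bool.false_ne_true

/-- **(E0) END-TO-END: the Booleans give `T.Valid b`.**  The per-rung file proves the six Booleans by
`decide +kernel` (bands glued with `band_append`), the three index facts by `decide +kernel` (never let the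
elaborator unfold the literal table: state band ends as numerals `N₁ = M₁ + 1`, `N₃ = M₃ + 1`), and applies this. -/
theorem valid_of_checks {N₁ N₃ : ℕ} (hN₁ : T.M₁ + 1 = N₁) (hN₃ : T.M₃ + 1 = N₃) (hM : T.M₁ + 1 ≤ T.M₃)
    (hb : b = P.bnum / P.bden) (hA : checkA P T X = true)
    (hB : checkB P T X 0 N₃ = true) (hBd : checkBd P T X 0 N₁ = true)
    (hC : checkC P T X 0 N₃ = true) (hCp : checkCp P T X 0 N₁ = true)
    (hD : checkD P T X 0 N₃ = true) : T.Valid b := by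
  subst hN₁ hN₃
  have F := afacts_of_checkA hb hA
  exact
  { hS := F.hS
    rePsi := fun n hn ↦ (sound_checkC F hC n (Nat.zero_le _) (by omega) (by omega)).2 hn
    rePsi' := fun n hn ↦ sound_checkCp F hCp n (Nat.zero_le _) (by omega) (by omega)
    imPsi := fun n hn ↦ (sound_checkC F hC n (Nat.zero_le _) (by omega) hn).1
    sin := fun n hn ↦ (sound_checkD F hD n (Nat.zero_le _) (by omega) hn).1
    cos := fun n hn ↦ (sound_checkD F hD n (Nat.zero_le _) (by omega) hn).2
    S0 := fun n hn ↦ (sound_checkB F hB n (Nat.zero_le _) (by omega) hn).1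
    S2 := fun n hn ↦ (sound_checkB F hB n (Nat.zero_le _) (by omega) hn).2
    Sdiag := fun n hn ↦ sound_checkBd F hBd n (Nat.zero_le _) (by omega) (by omega)
    pi := F.pi
    logPi := F.logPi
    logTwo := F.logTwo
    sqrtTwo := F.sqrtTwo
    eTot := F.eTot
    eTwo := F.eTwo
    sSq := F.sSq }

end SoundBands

end E0

end E0

end Summit.RiemannHypothesis.RiemannHypothesis.Theorems.S2FormatC

end
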